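import Mathlib
import Literature.AlgebraicGeometry.Resolution.AdicQuotient
import Literature.AlgebraicGeometry.Resolution.PowerSeriesRegularLocal
import Summits.ResolutionOfSingularities.ResolutionOfSingularities.Theorems.TeissierJungTeissierResolveToricNormalisationDimLeOneLemmas
import HarnessLib

/-!
# `TeissierResolve`, line Sketch — stub `stub_toricNormalisation_dimLeOne` (toric normalisation
# in dimension `≤ 1`: the normalisation is `k` or `k⟦s⟧`)

Crux `stmt-ResolutionOfSingularities-17086`
(`Summit.ResolutionOfSingularities.ResolutionOfSingularities.Theses.TeissierJung.TeissierResolve`),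
line "toric normalisation + destackification". This file proves the `d ≤ 1` slice
`stub_toricNormalisation_dimLeOne` of the lead skeleton (`Cruxes/TeissierResolve/Lines/Sketch.lean`,
v6, theorem `toricNormalisation`).

## Informal statement

Let `k` be an algebraically closed field (of characteristic `p`), `d ≤ 1`, and `B` a domain which
is a finite module over `k⟦x₁, …, x_d⟧` (`= k` or `k⟦t⟧`). Then the normalisation
`N = B̄ ⊆ Frac B` is ring-isomorphic to a completed simplicial toric ring `AdicCompletion 𝔪₀ S₀`,
`S₀ = k[y₁, …, y_{d'}]₀` the degree-`0` part of a weighted grading by a finite abelian group `A`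
(`MvPolynomial.weightedHomogeneousSubmodule k deg 0`, local instance
`MvPolynomial.weightedGradedAlgebra`), `𝔪₀ = ker (constantCoeff|_{S₀})`. In fact `N ≅ k` or
`N ≅ k⟦y⟧`, the TRIVIALLY graded targets `A = Unit`, `d' = 0, 1` (`S₀ = k[y₁..y_{d'}]`,
`𝔪₀ = (y)`).

## Proof

* Target side (`targetOfEquiv`, `targetOfUniformizer`): for weights into `Unit` every polynomial
  has degree `0`, so `S₀ → k[y]` is a ring isomorphism carrying `𝔪₀` to
  `ker constantCoeff`; for `d' = 0` this is `S₀ ≅ k`, `𝔪₀ = 0`, and `AdicCompletion 0 S₀ ≅ S₀ ≅ k`;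
  for `d' = 1` it is `S₀ ≅ k[X]`, `𝔪₀ ↦ (X)` (`MvPolynomial.uniqueAlgEquiv`), and
  `AdicCompletion 𝔪₀ S₀ ≅ k[X]^_{(X)}` (tree `adicCompletionCongr`).
* `d = 0`, or `d = 1` with `k⟦t⟧ → B` not injective (its kernel, a nonzero prime of the
  one-dimensional `k⟦t⟧`, is then `(t)`): `B` is integral over the image `k` of `k⟦x⟧`, so
  `k → N` is integral into a domain, hence bijective (`k` algebraically closed):
  `N ≅ k` (`nonempty_integralClosure_equiv_of_le_ker`), target `d' = 0`.
* `d = 1`, `k⟦t⟧ ↪ B`: `B` is a complete Noetherian local domain of dimension `1` (finite over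
  the complete DVR `k⟦t⟧`: tree `isLocalRing_of_isDomain_of_finite_of_isAdicComplete`,
  `isAdicComplete_maximalIdeal_of_finite`, `ringKrullDim_eq_of_isIntegral`,
  `isRegularLocalRing_mvPowerSeries_fin`), so `N` is a complete discrete valuation ring, finite
  over `B` (K–V II (3.17): tree `isDiscreteValuationRing_integralClosure_of_complete`), with
  residue field integral over `k`, hence `= k`: `N = k + sN` for a uniformiser `s`
  (`exists_uniformizer_integralClosure`). Then the level maps `k[X]/(Xⁿ) → N/(sⁿ)`, `X ↦ s`, are
  bijective and `N ≅ N^_{(s)} ≅ k[X]^_{(X)}` (`nonempty_equiv_adicCompletion_polynomial`, via the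
  tree's `adicCompletionEquivOfQuotientMap`) — the structure theorem for equicharacteristic
  complete discrete valuation rings with a coefficient field (Serre, *Local Fields* II §4,
  Cohen) — target `d' = 1`.

Sources: J.-P. Serre, *Local Fields*, Ch. II §4; K. Kiyek, J. L. Vicente, *Resolution of Curve
and Surface Singularities* (2004), Ch. II (3.17); H. Matsumura, *Commutative Ring Theory*
(1986), Thm. 8.7, 8.15. No definitions, no named facts. [folklore]
-/

noncomputable section

set_option linter.dupNamespace false -- mandated namespace of this single-conjunct summit

open IsLocalRing Polynomial
open Literature.AlgebraicGeometry.Resolution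
open Summit.ResolutionOfSingularities.ResolutionOfSingularities.Theorems.TeissierResolve.ToricNormalisationDimLeOneLemmas

namespace Summit.ResolutionOfSingularities.ResolutionOfSingularities.Theorems.TeissierResolve.ToricNormalisationDimLeOne

attribute [local instance] MvPolynomial.weightedGradedAlgebra

/-! ## The trivially graded targets `d' = 0, 1` -/

section Target

variable (k : Type) [Field k]

/-- For weights into the trivial group every polynomial is weighted homogeneous of degree `0`.
[folklore] -/
theorem mem_weightedHomogeneousSubmodule_unit (d : ℕ) (deg : Fin d → Unit)
    (p : MvPolynomial (Fin d) k) : p ∈ MvPolynomial.weightedHomogeneousSubmodule k deg 0 :=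
  fun _ _ => Subsingleton.elim _ _

/-- For weights into the trivial group, the inclusion `S₀ → k[y]` of the degree-`0` part is
bijective. [folklore] -/
theorem algebraMap_gradeZero_bijective (d : ℕ) (deg : Fin d → Unit) :
    Function.Bijective (algebraMap (MvPolynomial.weightedHomogeneousSubmodule k deg 0)
      (MvPolynomial (Fin d) k)) :=
  ⟨fun _ _ h => Subtype.ext h,
    fun p => ⟨⟨p, mem_weightedHomogeneousSubmodule_unit k d deg p⟩, rfl⟩⟩

/-- `d' = 0`: the augmentation `constantCoeff ∘ (S₀ ↪ k[∅])` is bijective, `S₀ ≅ k`. [folklore] -/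
theorem constantCoeff_comp_algebraMap_bijective (deg : Fin 0 → Unit) :
    Function.Bijective (MvPolynomial.constantCoeff.comp
      (algebraMap (MvPolynomial.weightedHomogeneousSubmodule k deg 0) (MvPolynomial (Fin 0) k))) :=
  (MvPolynomial.isEmptyRingEquiv k (Fin 0)).bijective.comp (algebraMap_gradeZero_bijective k 0 deg)

/-- **Target `d' = 0`: a ring isomorphic to `k` is a completed simplicial toric ring** (trivial
grading, no variables: `S₀ = k`, `𝔪₀ = 0`, `AdicCompletion 0 k ≅ k`). [folklore] -/
theorem targetOfEquiv (N : Type) [CommRing N] (e : N ≃+* k) :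
    ∃ (d' : ℕ) (A : Type) (_ : AddCommGroup A) (_ : Finite A) (_ : DecidableEq A)
      (deg : Fin d' → A),
      Nonempty (N ≃+*
        AdicCompletion
          (RingHom.ker (MvPolynomial.constantCoeff.comp
            (algebraMap (MvPolynomial.weightedHomogeneousSubmodule k deg 0)
              (MvPolynomial (Fin d') k))))
          (MvPolynomial.weightedHomogeneousSubmodule k deg 0)) := by
  let deg : Fin 0 → Unit := fun _ => 0
  have hbij := constantCoeff_comp_algebraMap_bijective k deg
  haveI : IsAdicComplete (RingHom.ker (MvPolynomial.constantCoeff.comp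
      (algebraMap (MvPolynomial.weightedHomogeneousSubmodule k deg 0) (MvPolynomial (Fin 0) k))))
      (MvPolynomial.weightedHomogeneousSubmodule k deg 0) := by
    rw [(RingHom.injective_iff_ker_eq_bot _).mp hbij.1]
    infer_instance
  exact ⟨0, Unit, inferInstance, inferInstance, inferInstance, deg, ⟨e.trans
    ((RingEquiv.ofBijective _ hbij).symm.trans (AdicCompletion.ofAlgEquiv _).toRingEquiv)⟩⟩

/-- `MvPolynomial.uniqueAlgEquiv : k[y] ≅ k[X]` preserves constant coefficients. [folklore] -/
theorem constantCoeff_comp_uniqueAlgEquiv :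
    Polynomial.constantCoeff.comp (MvPolynomial.uniqueAlgEquiv k (Fin 1)).toRingEquiv.toRingHom =
      (MvPolynomial.constantCoeff : MvPolynomial (Fin 1) k →+* k) :=
  MvPolynomial.ringHom_ext
    (fun r => by
      change Polynomial.constantCoeff (MvPolynomial.uniqueAlgEquiv k (Fin 1) (MvPolynomial.C r)) = _
      rw [MvPolynomial.uniqueAlgEquiv_apply, MvPolynomial.eval₂_C, Polynomial.constantCoeff_apply,
        Polynomial.coeff_C_zero, MvPolynomial.constantCoeff_C])
    (fun i => by
      change Polynomial.constantCoeff (MvPolynomial.uniqueAlgEquiv k (Fin 1) (MvPolynomial.X i)) = _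
      rw [MvPolynomial.uniqueAlgEquiv_apply, MvPolynomial.eval₂_X, Polynomial.constantCoeff_apply,
        Polynomial.coeff_X_zero, MvPolynomial.constantCoeff_X])

/-- `d' = 1`: there is a ring isomorphism `S₀ ≅ k[y] ≅ k[X]` carrying the irrelevant ideal `𝔪₀`
to `(X)`. [folklore] -/
theorem exists_gradeZero_equiv_polynomial (deg : Fin 1 → Unit) :
    ∃ e : MvPolynomial.weightedHomogeneousSubmodule k deg 0 ≃+* k[X],
      (RingHom.ker (MvPolynomial.constantCoeff.comp
        (algebraMap (MvPolynomial.weightedHomogeneousSubmodule k deg 0)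
          (MvPolynomial (Fin 1) k)))).map e.toRingHom = Ideal.span {(X : k[X])} := by
  let e : MvPolynomial.weightedHomogeneousSubmodule k deg 0 ≃+* k[X] :=
    (RingEquiv.ofBijective _ (algebraMap_gradeZero_bijective k 1 deg)).trans
      (MvPolynomial.uniqueAlgEquiv k (Fin 1)).toRingEquiv
  have h : MvPolynomial.constantCoeff.comp
      (algebraMap (MvPolynomial.weightedHomogeneousSubmodule k deg 0) (MvPolynomial (Fin 1) k)) =
      Polynomial.constantCoeff.comp e.toRingHom := by
    rw [← constantCoeff_comp_uniqueAlgEquiv]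
    rfl
  refine ⟨e, ?_⟩
  rw [h, ← RingHom.comap_ker, Ideal.map_comap_of_surjective e.toRingHom e.surjective,
    Polynomial.ker_constantCoeff]

/-- **Target `d' = 1`: an `(s)`-adically complete domain `N` with `N = ι(k) + sN` (`s ≠ 0` a
non-unit) is a completed simplicial toric ring** — `N ≅ k[X]^_{(X)} ≅ AdicCompletion (y) k[y]`
for the trivial grading in one variable. [folklore] -/
theorem targetOfUniformizer (N : Type) [CommRing N] [IsDomain N] (ι : k →+* N) (s : N)
    (hs0 : s ≠ 0) (hsu : ¬IsUnit s) (hres : ∀ x : N, ∃ c : k, x - ι c ∈ Ideal.span {s})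
    [IsAdicComplete (Ideal.span {s}) N] :
    ∃ (d' : ℕ) (A : Type) (_ : AddCommGroup A) (_ : Finite A) (_ : DecidableEq A)
      (deg : Fin d' → A),
      Nonempty (N ≃+*
        AdicCompletion
          (RingHom.ker (MvPolynomial.constantCoeff.comp
            (algebraMap (MvPolynomial.weightedHomogeneousSubmodule k deg 0)
              (MvPolynomial (Fin d') k))))
          (MvPolynomial.weightedHomogeneousSubmodule k deg 0)) := by
  let deg : Fin 1 → Unit := fun _ => 0
  obtain ⟨e, he⟩ := exists_gradeZero_equiv_polynomial k deg
  obtain ⟨f⟩ := nonempty_equiv_adicCompletion_polynomial ι s hs0 hsu hres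
  exact ⟨1, Unit, inferInstance, inferInstance, inferInstance, deg,
    ⟨f.trans (adicCompletionCongr _ _ e he).symm⟩⟩

end Target

/-! ## The stub -/

/-- **Toric normalisation in dimension `≤ 1`.** Over an algebraically closed field `k` (of
characteristic `p`), the normalisation of a domain `B` module-finite over `k⟦x₁..x_d⟧`, `d ≤ 1`,
is ring-isomorphic to a completed simplicial toric ring `AdicCompletion 𝔪₀ (k[y₁..y_{d'}]₀)`:
it is `k` (if `k⟦x⟧ → B` is not injective or `d = 0`: `B`, hence `B̄`, is integral over the
image `k`, and `k` is algebraically closed) or a complete discrete valuation ring with residue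
field `k` and a coefficient field, i.e. `k⟦s⟧ = k[X]^_{(X)}` (finiteness of normalisation of
complete one-dimensional local domains, K–V II (3.17); structure of equicharacteristic complete
DVRs, Serre II §4), and `k`, `k⟦s⟧` are the trivially graded targets `d' = 0, 1`. [folklore] -/
theorem stub_toricNormalisation_dimLeOne {p : ℕ} [Fact p.Prime] (k : Type) [Field k]
    [CharP k p] [IsAlgClosed k] (d : ℕ) (hd : d ≤ 1) (B : Type) [CommRing B] [IsDomain B]
    [Algebra (MvPowerSeries (Fin d) k) B] [Module.Finite (MvPowerSeries (Fin d) k) B] :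
    ∃ (d' : ℕ) (A : Type) (_ : AddCommGroup A) (_ : Finite A) (_ : DecidableEq A)
      (deg : Fin d' → A),
      Nonempty (integralClosure B (FractionRing B) ≃+*
        AdicCompletion
          (RingHom.ker (MvPolynomial.constantCoeff.comp
            (algebraMap (MvPolynomial.weightedHomogeneousSubmodule k deg 0)
              (MvPolynomial (Fin d') k))))
          (MvPolynomial.weightedHomogeneousSubmodule k deg 0)) := by
  obtain rfl | rfl : d = 0 ∨ d = 1 := by omega
  · -- `d = 0`: `B` is integral over the field `k⟦∅⟧ = k`, so `B̄ ≅ k`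
    obtain ⟨e⟩ := nonempty_integralClosure_equiv_of_le_ker (MvPowerSeries.C (σ := Fin 0))
      (⊥ : Ideal (MvPowerSeries (Fin 0) k))
      (fun a => by
        obtain ⟨c, rfl⟩ := MvPowerSeries.C_surjective a
        exact ⟨c, by rw [sub_self]; exact Submodule.zero_mem _⟩)
      B bot_le
    exact targetOfEquiv k _ e
  · -- `d = 1`: `k⟦t⟧` is a complete regular (discrete valuation) ring of dimension `1`
    have hreg := isRegularLocalRing_mvPowerSeries_fin k 1
    haveI := hreg.1
    have hdim : ringKrullDim (MvPowerSeries (Fin 1) k) = 1 := by rw [hreg.2, Nat.cast_one]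
    haveI : IsDomain (MvPowerSeries (Fin 1) k) := NoZeroDivisors.to_isDomain _
    by_cases hinj : Function.Injective (algebraMap (MvPowerSeries (Fin 1) k) B)
    · -- `k⟦t⟧ ↪ B`: `B̄` is a complete DVR with residue field `k`, `B̄ = k + s B̄ ≅ k⟦s⟧`
      haveI : IsAdicComplete (maximalIdeal (MvPowerSeries (Fin 1) k))
          (MvPowerSeries (Fin 1) k) := by
        rw [maximalIdeal_mvPowerSeries_eq_span k (Fin 1)]
        infer_instance
      obtain ⟨s, hs0, hsu, hres, hcpl⟩ := exists_uniformizer_integralClosure hdim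
        (MvPowerSeries.C (σ := Fin 1)) (exists_sub_C_mem_maximalIdeal (Fin 1) k) B hinj
      haveI := hcpl
      exact targetOfUniformizer k _
        ((algebraMap B _).comp ((algebraMap (MvPowerSeries (Fin 1) k) B).comp MvPowerSeries.C))
        s hs0 hsu hres
    · -- `k⟦t⟧ → B` not injective: its kernel is the maximal ideal `(t)`, so `B̄ ≅ k`
      haveI : Ring.KrullDimLE 1 (MvPowerSeries (Fin 1) k) := Ring.krullDimLE_iff.mpr hdim.le
      have hker : (RingHom.ker (algebraMap (MvPowerSeries (Fin 1) k) B)).IsMaximal :=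
        (RingHom.ker_isPrime _).isMaximal_of_ne_bot
          (fun h => hinj ((RingHom.injective_iff_ker_eq_bot _).mpr h))
      obtain ⟨e⟩ := nonempty_integralClosure_equiv_of_le_ker (MvPowerSeries.C (σ := Fin 1))
        (maximalIdeal (MvPowerSeries (Fin 1) k)) (exists_sub_C_mem_maximalIdeal (Fin 1) k) B
        (IsLocalRing.eq_maximalIdeal hker).ge
      exact targetOfEquiv k _ e

end Summit.ResolutionOfSingularities.ResolutionOfSingularities.Theorems.TeissierResolve.ToricNormalisationDimLeOne

end
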